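import Summits.Ventures.Crystal3D.Theses.StickyWulffConstant
import Summits.Ventures.Crystal3D.Theorems.StickyWulffConstantNoReconstructionGainExactLevelBound
import Summits.Ventures.Crystal3D.Theorems.StickyWulffConstantNoReconstructionGainExactFilmAboveCutAll
import Summits.Ventures.Crystal3D.Theorems.StickyWulffConstantNoReconstructionGainExactPrep
import Summits.Ventures.Crystal3D.Theorems.StickyWulffConstantNoReconstructionGainMovedPlug
import Summits.Ventures.Crystal3D.Theorems.StickyWulffConstantCoaxialWallLawTwoGrainLedger
import Summits.Ventures.Crystal3D.Theorems.StickyWulffConstantCoaxialWallLawForcedEnds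
import HarnessLib

/-!
# The crux `NoReconstructionGain`, placement-free (every rigidly moved fcc lattice, every window position)

HONEST FRAMING. Part of the venture `Summits/Ventures/Crystal3D` (cell `crystal3d-full`), helper `--supports` the
crux `NoReconstructionGain` (stmt-Ventures-19144, route `route-Ventures-StickyWulffConstant`), lead wulff-p1 g19.
CONDITIONAL ON THE CRUX (the main theorem takes `NoReconstructionGain` as a hypothesis): nothing here proves it.
First half of the answer to cf-p1 DECISION (clx) «ADHESION RE-LINED» (2026-08-29T08:12:53Z); the capped T-form
for fcc hosts follows in `…NoReconstructionGainAdhesionTForm`.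

* `noReconstructionGain_affine` — **the crux placement-free**: if `NoReconstructionGain` holds (lattice `Λ₀`,
  cylinder axis through the origin, window `[−2R, −R]`), then with `R' = R + 2` and `C' = 24√2π + |C|` it holds
  for every rigidly moved lattice `A Λ₀ + t`, every unit normal `ν`, every radius `ρ ≥ R'` and every finite
  packing `X` (a `Finset`) containing the moved slab sample: `2 φ(A⁻¹ν) π ρ² − C' ρ ≤ D(X)`.  Proof: pull back by
  `p ↦ A⁻¹p − c` with `c ∈ A⁻¹t + Λ₀` chosen by two uses of `exists_fcc_below_near` (reduce the origin modulo the
  lattice, then shift the window down by a lattice vector within `1` of `−3ν'`), so that heights shift by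
  `κ ∈ (−4, −2)` and the axis by `< 2` laterally; the pulled-back packing then contains the standard sample of
  radius `ρ − 2`, and `2φπ(ρ² − (ρ−2)²) ≤ 24√2 π ρ` (`φ ≤ 3√2`).
* bricks (with `lateral_norm_sq` / `lateral_add` of `…CoaxialWallLawForcedEnds`): sub-additivity of radii
  `radial_add_le`, `phi_finsum_bounds` (`0 ≤ φ ≤ 3√2`), `movedFcc_one_le_dist`, `exists_movedBody` (the clamped
  slab of a moved lattice in `ν`-coordinates as a `Finset`), `contactDeficiency_union_le_add`
  (`D(A ∪ B) ≤ D(A) + D(B)`, kissing number).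

WHAT THIS IS NOT: not a proof of the crux; no new case of the adhesion atom; rung F-C1 not moved.
-/

noncomputable section

namespace Summit.Ventures.Crystal3D.Theorems

open Summit.Ventures.Crystal3D Finset
open Literature.MathematicalPhysics.StatisticalMechanics (fccStacking barlowStacking constHagg isHaggSeq_const
  le_dist_of_mem_barlowStacking_ideal contactDeficiency)
open scoped InnerProductSpace

/-! ## Radial bookkeeping (`‖x‖² − ⟪x,ν⟫²` is the squared norm of the lateral part `x − ⟪x,ν⟫ν`, cf. `lateral_norm_sq`) -/

/-- Multiples of `ν` have no lateral part. -/
theorem lateral_smul_self {ν : EuclideanSpace ℝ (Fin 3)} (hν : ‖ν‖ = 1) (a : ℝ) :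
    a • ν - ⟪a • ν, ν⟫_ℝ • ν = 0 := by
  rw [inner_smul_left, real_inner_self_eq_norm_sq, hν]; simp

/-- Radial parts add sub-additively: `‖x‖²−⟪x,ν⟫² ≤ a²`, `‖y‖²−⟪y,ν⟫² ≤ b²` ⟹ `‖x+y‖²−⟪x+y,ν⟫² ≤ (a+b)²`. -/
theorem radial_add_le {ν : EuclideanSpace ℝ (Fin 3)} (hν : ‖ν‖ = 1) {x y : EuclideanSpace ℝ (Fin 3)}
    {a b : ℝ} (ha : 0 ≤ a) (hb : 0 ≤ b) (hx : ‖x‖ ^ 2 - ⟪x, ν⟫_ℝ ^ 2 ≤ a ^ 2)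
    (hy : ‖y‖ ^ 2 - ⟪y, ν⟫_ℝ ^ 2 ≤ b ^ 2) :
    ‖x + y‖ ^ 2 - ⟪x + y, ν⟫_ℝ ^ 2 ≤ (a + b) ^ 2 := by
  rw [← lateral_norm_sq ν x hν] at hx; rw [← lateral_norm_sq ν y hν] at hy
  rw [← lateral_norm_sq ν (x + y) hν]
  have hx' : ‖x - ⟪x, ν⟫_ℝ • ν‖ ≤ a := le_of_pow_le_pow_left₀ two_ne_zero ha hx
  have hy' : ‖y - ⟪y, ν⟫_ℝ • ν‖ ≤ b := le_of_pow_le_pow_left₀ two_ne_zero hb hy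
  have h : ‖(x + y) - ⟪x + y, ν⟫_ℝ • ν‖ ≤ a + b := by
    rw [lateral_add]
    exact (norm_add_le _ _).trans (add_le_add hx' hy')
  exact pow_le_pow_left₀ (norm_nonneg _) h 2

/-! ## `φ` is bounded -/

/-- `0 ≤ φ(ν) ≤ 3√2` for every `ν` with `‖ν‖ = 1` (twelve slots, each `|⟪w,ν⟫| ≤ 1`). -/
theorem phi_finsum_bounds {ν : EuclideanSpace ℝ (Fin 3)} (hν : ‖ν‖ = 1) :
    0 ≤ Real.sqrt 2 / 4 * ∑ᶠ w ∈ {w ∈ fccStacking 1 (Real.sqrt (2 / 3)) | ‖w‖ = 1}, |⟪w, ν⟫_ℝ| ∧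
    Real.sqrt 2 / 4 * ∑ᶠ w ∈ {w ∈ fccStacking 1 (Real.sqrt (2 / 3)) | ‖w‖ = 1}, |⟪w, ν⟫_ℝ| ≤
      3 * Real.sqrt 2 := by
  rw [finsum_unit_fcc_eq_sum]
  have h2 : 0 ≤ Real.sqrt 2 := Real.sqrt_nonneg _
  have hle : ∑ w ∈ fccSlots, |⟪w, ν⟫_ℝ| ≤ 12 := by
    calc ∑ w ∈ fccSlots, |⟪w, ν⟫_ℝ| ≤ ∑ w ∈ fccSlots, (1 : ℝ) := by
          refine Finset.sum_le_sum fun w hw => ?_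
          calc |⟪w, ν⟫_ℝ| ≤ ‖w‖ * ‖ν‖ := abs_real_inner_le_norm w ν
            _ = 1 := by rw [norm_eq_one_of_mem_fccSlots hw, hν, one_mul]
      _ = 12 := by rw [Finset.sum_const, card_fccSlots]; simp
  have hge : 0 ≤ ∑ w ∈ fccSlots, |⟪w, ν⟫_ℝ| := Finset.sum_nonneg fun w _ => abs_nonneg _
  constructor
  · positivity
  · nlinarith

/-! ## The crux, placement-free -/

/-- **`NoReconstructionGain` placement-free.**  If the crux holds (for the lattice `Λ₀`, window `[−2R,−R]`, axis
through the origin), then for `R' = R + 2` and a constant `C'`: for every linear isometry `A`, translation `t`, unit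
normal `ν`, radius `ρ ≥ R'` and every finite packing `X` containing every site `p` of the moved lattice `A Λ₀ + t`
with `−2R' ≤ ⟪p,ν⟫ ≤ −R'` and `‖p‖² − ⟪p,ν⟫² ≤ ρ²`, one has `2 φ(A⁻¹ν) π ρ² − C' ρ ≤ D(X)`. -/
theorem noReconstructionGain_affine
    (hNRG : Summit.Ventures.Crystal3D.Theses.StickyWulffConstant.NoReconstructionGain) :
    ∃ R C : ℝ, 2 ≤ R ∧ ∀ (A : EuclideanSpace ℝ (Fin 3) ≃ₗᵢ[ℝ] EuclideanSpace ℝ (Fin 3))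
      (t ν : EuclideanSpace ℝ (Fin 3)), ‖ν‖ = 1 → ∀ ρ : ℝ, R ≤ ρ →
      ∀ X : Finset (EuclideanSpace ℝ (Fin 3)), (∀ p ∈ X, ∀ q ∈ X, p ≠ q → 1 ≤ dist p q) →
      (∀ p ∈ (fun q => A q + t) '' fccStacking 1 (Real.sqrt (2 / 3)),
        -(2 * R) ≤ ⟪p, ν⟫_ℝ → ⟪p, ν⟫_ℝ ≤ -R → ‖p‖ ^ 2 - ⟪p, ν⟫_ℝ ^ 2 ≤ ρ ^ 2 → p ∈ X) →
      2 * (Real.sqrt 2 / 4 * ∑ᶠ w ∈ {w ∈ fccStacking 1 (Real.sqrt (2 / 3)) | ‖w‖ = 1},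
          |⟪w, A.symm ν⟫_ℝ|) * Real.pi * ρ ^ 2 - C * ρ ≤ contactDeficiency X := by
  classical
  obtain ⟨R₀, C₀, hR₀, hN⟩ := hNRG
  refine ⟨R₀ + 2, 24 * Real.sqrt 2 * Real.pi + |C₀|, by linarith, ?_⟩
  intro A t ν hν ρ hρ X hX hslab
  -- the pulled-back normal and origin
  set ν' : EuclideanSpace ℝ (Fin 3) := A.symm ν with hν'def
  have hν' : ‖ν'‖ = 1 := by rw [hν'def, LinearIsometryEquiv.norm_map, hν]
  have hAν' : A ν' = ν := by rw [hν'def, LinearIsometryEquiv.apply_symm_apply]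
  set s' : EuclideanSpace ℝ (Fin 3) := A.symm t with hs'def
  have hAs' : A s' = t := by rw [hs'def, LinearIsometryEquiv.apply_symm_apply]
  -- reduce the origin modulo the lattice: `u = s' + ℓ₁`, `‖u‖ < 1`
  obtain ⟨ℓ₁, hℓ₁Λ, -, hℓ₁d⟩ := exists_fcc_below_near hν' (-s')
  set u : EuclideanSpace ℝ (Fin 3) := s' + ℓ₁ with hudef
  have hu : ‖u‖ < 1 := by
    have : dist (-s') ℓ₁ = ‖u‖ := by
      rw [dist_eq_norm, hudef, ← norm_neg (s' + ℓ₁)]; congr 1; abel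
    rw [← this]; exact hℓ₁d
  -- shift the window down by `≈ 3`: `ℓ₂` near `y = (−3 − ⟪u,ν'⟫) ν'`
  set σ₁ : ℝ := ⟪u, ν'⟫_ℝ with hσ₁def
  set y : EuclideanSpace ℝ (Fin 3) := (-3 - σ₁) • ν' with hydef
  obtain ⟨ℓ₂, hℓ₂Λ, -, hℓ₂d⟩ := exists_fcc_below_near hν' y
  have hℓ₂y : ‖ℓ₂ - y‖ < 1 := by rw [← dist_eq_norm, dist_comm]; exact hℓ₂d
  set c : EuclideanSpace ℝ (Fin 3) := u + ℓ₂ with hcdef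
  set κ : ℝ := ⟪c, ν'⟫_ℝ with hκdef
  -- `κ ∈ (−4, −2)`
  have hκ : -4 < κ ∧ κ < -2 := by
    have hy : ⟪y, ν'⟫_ℝ = -3 - σ₁ := by
      rw [hydef, inner_smul_left, real_inner_self_eq_norm_sq, hν']; simp
    have he : |⟪ℓ₂ - y, ν'⟫_ℝ| < 1 := by
      calc |⟪ℓ₂ - y, ν'⟫_ℝ| ≤ ‖ℓ₂ - y‖ * ‖ν'‖ := abs_real_inner_le_norm _ _
        _ < 1 := by rw [hν', mul_one]; exact hℓ₂y
    have hκe : κ = -3 + ⟪ℓ₂ - y, ν'⟫_ℝ := by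
      rw [hκdef, hcdef, inner_add_left, inner_sub_left, hy, hσ₁def]; ring
    rw [hκe]
    constructor <;> linarith [(abs_lt.1 he).1, (abs_lt.1 he).2]
  -- lateral part of `c` is `< 2`
  have hc_rad : ‖c‖ ^ 2 - ⟪c, ν'⟫_ℝ ^ 2 ≤ 2 ^ 2 := by
    rw [← lateral_norm_sq ν' c hν']
    have h1 : ‖c - ⟪c, ν'⟫_ℝ • ν'‖ ≤ 2 := by
      rw [hcdef, lateral_add]
      have e : ℓ₂ - ⟪ℓ₂, ν'⟫_ℝ • ν' = ((ℓ₂ - y) - ⟪ℓ₂ - y, ν'⟫_ℝ • ν') + (y - ⟪y, ν'⟫_ℝ • ν') := by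
        rw [← lateral_add, sub_add_cancel]
      rw [e, hydef, lateral_smul_self hν', add_zero]
      calc ‖(u - ⟪u, ν'⟫_ℝ • ν') + ((ℓ₂ - (-3 - σ₁) • ν') - ⟪ℓ₂ - (-3 - σ₁) • ν', ν'⟫_ℝ • ν')‖
          ≤ ‖u - ⟪u, ν'⟫_ℝ • ν'‖ + ‖(ℓ₂ - (-3 - σ₁) • ν') - ⟪ℓ₂ - (-3 - σ₁) • ν', ν'⟫_ℝ • ν'‖ :=
            norm_add_le _ _
        _ ≤ ‖u‖ + ‖ℓ₂ - (-3 - σ₁) • ν'‖ := add_le_add (lateral_norm_le ν' _ hν') (lateral_norm_le ν' _ hν')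
        _ ≤ 2 := by rw [← hydef]; linarith
    exact pow_le_pow_left₀ (norm_nonneg _) h1 2
  -- the pull-back `Ψ p = A⁻¹ p − c`
  set Ψ : EuclideanSpace ℝ (Fin 3) → EuclideanSpace ℝ (Fin 3) := fun p => A.symm (p - A c) with hΨdef
  have hΨi : Isometry Ψ := isometry_pullback A (A c)
  have hΨ : ∀ p, Ψ p = A.symm p - c := by
    intro p; rw [hΨdef]; simp only [map_sub, LinearIsometryEquiv.symm_apply_apply]
  set X' : Finset (EuclideanSpace ℝ (Fin 3)) := X.image Ψ with hX'def
  have hX' : ∀ p ∈ X', ∀ q ∈ X', p ≠ q → 1 ≤ dist p q := by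
    intro p hp q hq hpq
    obtain ⟨p₀, hp₀, rfl⟩ := mem_image.1 hp
    obtain ⟨q₀, hq₀, rfl⟩ := mem_image.1 hq
    rw [hΨi.dist_eq]
    exact hX p₀ hp₀ q₀ hq₀ fun e => hpq (by rw [e])
  -- the standard sample of radius `ρ − 2` lies in `X'`
  have hρ2 : 0 ≤ ρ - 2 := by linarith
  have hsample : ∀ q ∈ fccStacking 1 (Real.sqrt (2 / 3)), -(2 * R₀) ≤ ⟪q, ν'⟫_ℝ → ⟪q, ν'⟫_ℝ ≤ -R₀ →
      ‖q‖ ^ 2 - ⟪q, ν'⟫_ℝ ^ 2 ≤ (ρ - 2) ^ 2 → q ∈ X' := by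
    intro q hq h1 h2 h3
    set p : EuclideanSpace ℝ (Fin 3) := A (q + c) with hpdef
    have hpS : p ∈ (fun q => A q + t) '' fccStacking 1 (Real.sqrt (2 / 3)) := by
      refine ⟨q + ℓ₁ + ℓ₂, fcc_add_site_mem (fcc_add_site_mem hq hℓ₁Λ) hℓ₂Λ, ?_⟩
      show A (q + ℓ₁ + ℓ₂) + t = p
      rw [hpdef, hcdef, hudef, ← hAs']
      simp only [map_add]; abel
    have hpν : ⟪p, ν⟫_ℝ = ⟪q, ν'⟫_ℝ + κ := by
      rw [hpdef, ← hAν', LinearIsometryEquiv.inner_map_map, inner_add_left, hκdef]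
    have hprad : ‖p‖ ^ 2 - ⟪p, ν⟫_ℝ ^ 2 ≤ ρ ^ 2 := by
      have e1 : ‖p‖ = ‖q + c‖ := by rw [hpdef, LinearIsometryEquiv.norm_map]
      have e2 : ⟪p, ν⟫_ℝ = ⟪q + c, ν'⟫_ℝ := by
        rw [hpdef, ← hAν', LinearIsometryEquiv.inner_map_map]
      rw [e1, e2]
      have := radial_add_le hν' hρ2 (by norm_num : (0:ℝ) ≤ 2) h3 hc_rad
      have e3 : (ρ - 2 + 2) = ρ := by ring
      rw [e3] at this
      exact this
    have hpX : p ∈ X := hslab p hpS (by linarith [hκ.1]) (by linarith [hκ.2]) hprad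
    rw [hX'def, mem_image]
    refine ⟨p, hpX, ?_⟩
    rw [hΨ, hpdef, LinearIsometryEquiv.symm_apply_apply, add_sub_cancel_right]
  -- enumerate `X'` and apply the crux at radius `ρ − 2`
  obtain ⟨N, x, hx, hcov, hD⟩ := exists_unitPacking_of_finset X' hX'
  have hmain := hN ν' hν' (ρ - 2) (by linarith) N x hx
    (fun q hq h1 h2 h3 => hcov q (hsample q hq h1 h2 h3))
  rw [hD, hX'def, contactDeficiency_image_of_isometry hΨi] at hmain
  -- arithmetic
  obtain ⟨hφ0, hφ1⟩ := phi_finsum_bounds hν'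
  set φ := Real.sqrt 2 / 4 * ∑ᶠ w ∈ {w ∈ fccStacking 1 (Real.sqrt (2 / 3)) | ‖w‖ = 1}, |⟪w, ν'⟫_ℝ|
    with hφdef
  have hπ : 0 ≤ Real.pi := Real.pi_pos.le
  have hρ0 : 0 ≤ ρ := by linarith
  have h1 : 2 * φ * Real.pi * ρ ^ 2 - 2 * φ * Real.pi * (ρ - 2) ^ 2 ≤ 24 * Real.sqrt 2 * Real.pi * ρ := by
    have : 2 * φ * Real.pi * ρ ^ 2 - 2 * φ * Real.pi * (ρ - 2) ^ 2 = 2 * φ * Real.pi * (4 * ρ - 4) := by ring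
    rw [this]
    have h4 : 2 * φ * Real.pi * (4 * ρ - 4) ≤ 2 * φ * Real.pi * (4 * ρ) :=
      mul_le_mul_of_nonneg_left (by linarith) (by positivity)
    have h5 : φ * (Real.pi * ρ) ≤ 3 * Real.sqrt 2 * (Real.pi * ρ) :=
      mul_le_mul_of_nonneg_right hφ1 (mul_nonneg hπ hρ0)
    have h6 : 2 * φ * Real.pi * (4 * ρ) ≤ 24 * Real.sqrt 2 * Real.pi * ρ := by
      have e1 : 2 * φ * Real.pi * (4 * ρ) = 8 * (φ * (Real.pi * ρ)) := by ring
      have e2 : 24 * Real.sqrt 2 * Real.pi * ρ = 8 * (3 * Real.sqrt 2 * (Real.pi * ρ)) := by ring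
      rw [e1, e2]; linarith
    linarith
  have h2 : C₀ * (ρ - 2) ≤ |C₀| * ρ := by
    calc C₀ * (ρ - 2) ≤ |C₀| * (ρ - 2) := mul_le_mul_of_nonneg_right (le_abs_self _) hρ2
      _ ≤ |C₀| * ρ := mul_le_mul_of_nonneg_left (by linarith) (abs_nonneg _)
  linarith

/-! ## Moved lattices: separation, clamped slabs as finite sets, sub-additivity of the deficiency -/

/-- Sites of a rigidly moved copy of `Λ₀` are pairwise `≥ 1` apart. -/
theorem movedFcc_one_le_dist (L : EuclideanSpace ℝ (Fin 3) ≃ₗᵢ[ℝ] EuclideanSpace ℝ (Fin 3))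
    (s : EuclideanSpace ℝ (Fin 3)) {x y : EuclideanSpace ℝ (Fin 3)}
    (hx : x ∈ (fun r => L r + s) '' fccStacking 1 (Real.sqrt (2 / 3)))
    (hy : y ∈ (fun r => L r + s) '' fccStacking 1 (Real.sqrt (2 / 3))) (hxy : x ≠ y) : 1 ≤ dist x y := by
  obtain ⟨q, hq, rfl⟩ := hx
  obtain ⟨q', hq', rfl⟩ := hy
  have hne : q ≠ q' := by rintro rfl; exact hxy rfl
  have h := le_dist_of_mem_barlowStacking_ideal isHaggSeq_const one_pos fcc_height_sq hq hq' hne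
  simpa [dist_add_right, L.dist_map] using h

/-- The clamped slab of a moved lattice `L Λ₀ + s` in `ν`-coordinates, as a `Finset`. -/
theorem exists_movedBody (L : EuclideanSpace ℝ (Fin 3) ≃ₗᵢ[ℝ] EuclideanSpace ℝ (Fin 3))
    (s ν : EuclideanSpace ℝ (Fin 3)) (a b ρ : ℝ) :
    ∃ Bd : Finset (EuclideanSpace ℝ (Fin 3)), ∀ z, z ∈ Bd ↔
      (z ∈ (fun r => L r + s) '' fccStacking 1 (Real.sqrt (2 / 3)) ∧ a ≤ ⟪z, ν⟫_ℝ ∧ ⟪z, ν⟫_ℝ ≤ b ∧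
        ‖z‖ ^ 2 - ⟪z, ν⟫_ℝ ^ 2 ≤ ρ ^ 2) := by
  classical
  have hfin := fcc_uniformlyDiscrete.finite_inter_closedBall 0 (|ρ| + |a| + |b| + ‖s‖)
  refine ⟨(hfin.toFinset.image fun r => L r + s).filter fun z =>
      a ≤ ⟪z, ν⟫_ℝ ∧ ⟪z, ν⟫_ℝ ≤ b ∧ ‖z‖ ^ 2 - ⟪z, ν⟫_ℝ ^ 2 ≤ ρ ^ 2, fun z => ?_⟩
  rw [Finset.mem_filter, Finset.mem_image]
  constructor
  · rintro ⟨⟨r, hr, rfl⟩, h1, h2, h3⟩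
    rw [Set.Finite.mem_toFinset, Set.mem_inter_iff] at hr
    exact ⟨⟨r, hr.1, rfl⟩, h1, h2, h3⟩
  · rintro ⟨⟨r, hrΛ, rfl⟩, h1, h2, h3⟩
    refine ⟨⟨r, ?_, rfl⟩, h1, h2, h3⟩
    rw [Set.Finite.mem_toFinset, Set.mem_inter_iff, Metric.mem_closedBall, dist_zero_right]
    refine ⟨hrΛ, ?_⟩
    set z := L r + s with hz
    have hh : |⟪z, ν⟫_ℝ| ≤ |a| + |b| := by
      rw [abs_le]; constructor
      · linarith [neg_abs_le a, abs_nonneg b]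
      · linarith [le_abs_self b, abs_nonneg a]
    have h4 : ‖z‖ ^ 2 ≤ (|ρ| + |a| + |b|) ^ 2 := by
      have : ⟪z, ν⟫_ℝ ^ 2 ≤ (|a| + |b|) ^ 2 := by
        rw [← sq_abs]; exact pow_le_pow_left₀ (abs_nonneg _) hh 2
      have hρ2 : ρ ^ 2 = |ρ| ^ 2 := (sq_abs ρ).symm
      nlinarith [abs_nonneg ρ, abs_nonneg a, abs_nonneg b]
    have hz' : ‖z‖ ≤ |ρ| + |a| + |b| := le_of_pow_le_pow_left₀ two_ne_zero (by positivity) h4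
    have hr : ‖r‖ = ‖z - s‖ := by rw [hz, add_sub_cancel_right, L.norm_map]
    rw [hr]
    exact (norm_sub_le _ _).trans (by linarith)

/-- `D(A ∪ B) ≤ D(A) + D(B)` whenever `A ∩ B` is a unit packing (kissing number). -/
theorem contactDeficiency_union_le_add (A B : Finset (EuclideanSpace ℝ (Fin 3)))
    (hAB : ∀ p ∈ A ∩ B, ∀ q ∈ A ∩ B, p ≠ q → 1 ≤ dist p q) :
    contactDeficiency (A ∪ B) ≤ contactDeficiency A + contactDeficiency B := by
  have h := contactDeficiency_union_add_inter A B
  have h0 := contactDeficiency_nonneg_of_packing (A ∩ B) hAB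
  have h1 : (0 : ℝ) ≤ (((((A \ B) ×ˢ (B \ A)).filter fun pq => dist pq.1 pq.2 = 1).card : ℕ) : ℝ) :=
    Nat.cast_nonneg _
  linarith

end Summit.Ventures.Crystal3D.Theorems

end
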